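import Summits.KontsevichZagierPeriods.KontsevichZagierPeriods.Theorems.ReducedPeriodRing.Negative.SliceFunctional
import Summits.KontsevichZagierPeriods.KontsevichZagierPeriods.Theorems.FurushoPentagonReducedPeriodRingDefs
import Literature.NumberTheory.Transcendental.KZProductIdeal
import Literature.NumberTheory.Transcendental.LindemannWeierstrassProofs
import Mathlib.Analysis.SpecialFunctions.Trigonometric.ArctanDeriv
import Mathlib.Analysis.Analytic.Polynomial

/-!
# `ReducedPeriodRing` (stmt-KontsevichZagierPeriods-3929) — kernel control modulo `κ`-powers FAILS
for the last-coordinate Stokes presentation (line `ayoub-stokes-cartier`, stub `stub_kernelControlModPi`)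

The registered stub `stub_kernelControlModPi` of line `ayoub-stokes-cartier` asserts: for the
arctangent kernel `κ = [[0,1], du/((1−u)²+u²)]`, every `ℤ`-combination `a` of tame cube classes
with `a ∈ KZ.relations` has `[κ]^N ⋆ a ∈ closure (KZ.cubicalLinGens ∪ KZ.cubicalStokesGens)` for
some `N`. This file REFUTES it (`not_kernelControlModPi`, the registered signature with the line's
local abbreviations `IsKappa`, `ayoubIdeal` unfolded; quantitative form
`exists_kappa_iterate_not_mem_closure_lin_stokes`).

Certificate: the slice functionals `Sl N` of `Negative/SliceFunctional.lean` are algebraic-valued on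
that closure for every `N`; prefixing a factor `[κ]` shifts the level by one
(`slice_succ_kappa_mul`: the new first coordinate carries the Dirac mass at `0`, where the kernel
equals `1`), so `Sl N ([κ]^N ⋆ a) = Sl 0 a`; and for the dyadic SUBDIVISION relation
`a₀ = [g] − [½ g(·/2)] − [½ g((1+·)/2)]` of the tame cube class of
`g = d/dt arctan (−16t² + 16t − 3)` one gets `Sl 0 a₀ = (arctan 1 − arctan(−3)) − (arctan 0 −
arctan(−3)) − (arctan 0 − arctan 1) = π/2`, transcendental (Lindemann, `transcendental_pi_holds`).
Diagnosis for the planners: without change-of-variables generators the presentation has no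
coordinate PERMUTATIONS, so Newton–Leibniz along the last coordinate only is not Ayoub's relation
module (Ayoub 2014, Def. 10: `∂f/∂zᵢ − f|_{zᵢ=1} + f|_{zᵢ=0}` for every `i`); the slice functionals
die once Stokes in every coordinate is adjoined. No definitions (file-local notations).
[Ayoub 2014, Def. 10; Kontsevich–Zagier 2001, §1.2, §4.1; Lindemann 1882]
-/

noncomputable section

namespace Summit.KontsevichZagierPeriods.KontsevichZagierPeriods.ReducedPeriodRingNegative

open Literature.NumberTheory.Transcendental
open Literature.NumberTheory.Transcendental.KZ hiding cubicalSpan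
open MeasureTheory Set MvPolynomial
open Summit.KontsevichZagierPeriods.FurushoPentagon.ReducedPeriodRing (unitCube cubicalGens cubicalSpan)

/-- The slice profile (file-local notation, as in `Negative/SliceFunctional.lean`): Dirac mass at
`0` for coordinates `i < N`, Lebesgue measure on `[0, ½]` for `i = N`, on `[0, 1]` for `i > N`. -/
local notation3 "σₛ[" N ", " i "]" =>
  (if (i : ℕ) < (N : ℕ) then Measure.dirac (0 : ℝ)
    else if (i : ℕ) = (N : ℕ) then (volume : Measure ℝ).restrict (Set.Icc (0 : ℝ) (1 / 2))
    else (volume : Measure ℝ).restrict (Set.Icc (0 : ℝ) 1))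

/-- The slice product measure on `ℝⁿ` of level `N` (file-local notation). -/
local notation3 "πₛ[" N ", " n "]" => Measure.pi fun i : Fin n => σₛ[N, (i : ℕ)]

/-- The slice functional of level `N` (file-local notation). -/
local notation3 "Sl[" N "]" =>
  (FreeAbelianGroup.lift fun g : (Σ n, IntegralRep n) =>
    ∫ x in g.2.domain, g.2.integrand x ∂(πₛ[N, g.1]) : FormalRep →+ ℝ)

/-! ## §4 Prefixing the kernel `κ` shifts the slice level by one -/

/-- Appending one coordinate in front transports `(Dirac at 0) × (slice level N)` to slice level
`N + 1`. [folklore] -/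
theorem measurePreserving_append_slicePi (N d : ℕ) :
    MeasurePreserving (KZ.appendMeasurableEquiv 1 d)
      ((Measure.pi fun _ : Fin 1 => Measure.dirac (0 : ℝ)).prod (πₛ[N, d])) (πₛ[N + 1, 1 + d]) := by
  have hI := isFiniteMeasure_sliceMeasure (N + 1)
  have h := (measurePreserving_sumPiEquivProdPi_symm
      (fun s : Fin 1 ⊕ Fin d => σₛ[N + 1, ((finSumFinEquiv s : Fin (1 + d)) : ℕ)])).trans
    (measurePreserving_piCongrLeft (μ := fun i : Fin (1 + d) => σₛ[N + 1, (i : ℕ)]) finSumFinEquiv)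
  have hA : (Measure.pi fun i : Fin 1 =>
      σₛ[N + 1, ((finSumFinEquiv (Sum.inl i : Fin 1 ⊕ Fin d) : Fin (1 + d)) : ℕ)]) =
      Measure.pi fun _ : Fin 1 => Measure.dirac (0 : ℝ) := by
    congr 1
    funext i
    rw [finSumFinEquiv_apply_left]
    exact sliceMeasure_of_lt (by simp)
  have hB : (Measure.pi fun j : Fin d =>
      σₛ[N + 1, ((finSumFinEquiv (Sum.inr j : Fin 1 ⊕ Fin d) : Fin (1 + d)) : ℕ)]) = πₛ[N, d] := by
    congr 1
    funext j
    rw [finSumFinEquiv_apply_right, Fin.val_natAdd]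
    exact sliceMeasure_succ_one_add N j
  rw [hA, hB] at h
  exact h

/-- **Peeling one `κ` on a generator**: `Sl (N+1) ([κ] ⋆ [S]) = κ(0) · Sl N [S] = Sl N [S]`
(Fubini for the product representation; the first coordinate carries the Dirac mass at `0`, where
the arctangent kernel `1/((1−u)²+u²)` takes the value `1`). [Kontsevich–Zagier 2001, §4.1] -/
theorem slice_succ_kappa_mul_of (N : ℕ) {κ : IntegralRep 1}
    (hκd : κ.domain = {x | x 0 ∈ Icc (0 : ℝ) 1})
    (hκi : κ.integrand = fun x => 1 / ((1 - x 0) ^ 2 + x 0 ^ 2)) {d : ℕ} (S : IntegralRep d) :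
    Sl[N + 1] (of κ * of S) = Sl[N] (of S) := by
  classical
  have hI := isFiniteMeasure_sliceMeasure N
  rw [of_mul_of, slice_of, slice_of, IntegralRep.prod_domain, IntegralRep.prod_integrand_eq,
    ← (measurePreserving_append_slicePi N d).setIntegral_preimage_emb
      (KZ.appendMeasurableEquiv 1 d).measurableEmbedding, IntegralRep.preimage_prodDomain]
  simp only [KZ.appendMeasurableEquiv_apply, IntegralRep.prodFun_append]
  rw [setIntegral_prod_mul, pi_dirac_zero, setIntegral_dirac, if_pos, hκi]
  · simp
  · rw [hκd]
    exact ⟨le_rfl, zero_le_one⟩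

/-- **Peeling one `κ`**: `Sl (N+1) ([κ] ⋆ x) = Sl N x` for every `x : FormalRep`. [folklore] -/
theorem slice_succ_kappa_mul (N : ℕ) {κ : IntegralRep 1}
    (hκd : κ.domain = {x | x 0 ∈ Icc (0 : ℝ) 1})
    (hκi : κ.integrand = fun x => 1 / ((1 - x 0) ^ 2 + x 0 ^ 2)) (x : FormalRep) :
    Sl[N + 1] (of κ * x) = Sl[N] x := by
  induction x using FreeAbelianGroup.induction_on with
  | zero => simp
  | of g =>
    obtain ⟨d, S⟩ := g
    exact slice_succ_kappa_mul_of N hκd hκi S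
  | neg g ih => rw [mul_neg, map_neg, map_neg, ih]
  | add x y hx hy => rw [mul_add, map_add, map_add, hx, hy]

/-- **Peeling all `κ`'s**: the slice functional of level `N` on `[κ]^N ⋆ a` is the slice functional of
level `0` on `a`. [folklore] -/
theorem slice_iterate_kappa_mul {κ : IntegralRep 1}
    (hκd : κ.domain = {x | x 0 ∈ Icc (0 : ℝ) 1})
    (hκi : κ.integrand = fun x => 1 / ((1 - x 0) ^ 2 + x 0 ^ 2)) (a : FormalRep) (N : ℕ) :
    Sl[N] ((fun x => of κ * x)^[N] a) = Sl[0] a := by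
  induction N with
  | zero => rfl
  | succ N ih => rw [Function.iterate_succ_apply', slice_succ_kappa_mul N hκd hκi, ih]

/-! ## §5 Tame cube classes of one-variable rational functions, and their level-`0` slices -/

/-- A quotient of polynomials over `ℚ` in one real variable with non-vanishing denominator is real
analytic. [folklore] -/
theorem analyticOnNhd_aeval_div (p q : MvPolynomial (Fin 1) ℚ) (hq : ∀ x : Fin 1 → ℝ, aeval x q ≠ 0)
    (S : Set (Fin 1 → ℝ)) : AnalyticOnNhd ℝ (fun x : Fin 1 → ℝ => aeval x p / aeval x q) S := by
  have hX : ∀ i : Fin 1, AnalyticOnNhd ℝ (fun x : Fin 1 → ℝ => x i) Set.univ := fun i =>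
    (ContinuousLinearMap.proj (R := ℝ) (φ := fun _ : Fin 1 => ℝ) i).analyticOnNhd _
  have hp : AnalyticOnNhd ℝ (fun x : Fin 1 → ℝ => aeval x p) Set.univ :=
    AnalyticOnNhd.aeval_mvPolynomial (f := fun (x : Fin 1 → ℝ) (i : Fin 1) => x i) hX p
  have hq' : AnalyticOnNhd ℝ (fun x : Fin 1 → ℝ => aeval x q) Set.univ :=
    AnalyticOnNhd.aeval_mvPolynomial (f := fun (x : Fin 1 → ℝ) (i : Fin 1) => x i) hX q
  exact (hp.div hq' fun x _ => hq x).mono (Set.subset_univ S)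

/-- **The level-`0` slice of a one-dimensional cube class is `∫₀^{1/2}` of its integrand.**
[folklore] -/
theorem slice_zero_of_dim_one (r : IntegralRep 1) (hr : r.domain = KZ.cube 1) :
    Sl[0] (of r) = ∫ t in Icc (0 : ℝ) (1 / 2), r.integrand (fun _ => t) := by
  have hpi : πₛ[0, 1] = Measure.pi fun _ : Fin 1 => volume.restrict (Icc (0 : ℝ) (1 / 2)) := by
    congr 1
    funext i
    rw [Fin.val_eq_zero i, sliceMeasure_self]
  rw [slice_of, hr, hpi]
  have hmp := measurePreserving_funUnique (volume.restrict (Icc (0 : ℝ) (1 / 2))) (Fin 1)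
  have hpre : (MeasurableEquiv.funUnique (Fin 1) ℝ) ⁻¹' Icc (0 : ℝ) 1 = KZ.cube 1 := by
    ext x
    simp [KZ.mem_cube, Fin.forall_fin_one]
  have hfun : EqOn r.integrand
      (fun x => r.integrand fun _ => MeasurableEquiv.funUnique (Fin 1) ℝ x) (KZ.cube 1) := by
    intro x _
    simp only [MeasurableEquiv.funUnique_apply]
    congr 1
    funext i
    rw [Fin.eq_zero i]
    rfl
  have htrans := hmp.setIntegral_preimage_emb (MeasurableEquiv.funUnique (Fin 1) ℝ).measurableEmbedding
    (fun t : ℝ => r.integrand fun _ => t) (Icc (0 : ℝ) 1)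
  rw [hpre] at htrans
  rw [setIntegral_congr_fun KZ.measurableSet_cube hfun]
  exact htrans.trans (setIntegral_Icc_restrict_Icc _ (by norm_num))

/-- `∫₀^{1/2} g = G(½) − G(0)` for a primitive `G` of a continuous `g`. [folklore] -/
theorem integral_Icc_half_of_hasDerivAt {g G : ℝ → ℝ} (hderiv : ∀ t, HasDerivAt G (g t) t)
    (hcont : Continuous g) : ∫ t in Icc (0 : ℝ) (1 / 2), g t = G (1 / 2) - G 0 := by
  rw [integral_Icc_eq_integral_Ioc, ← intervalIntegral.integral_of_le (by norm_num : (0 : ℝ) ≤ 1 / 2)]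
  exact intervalIntegral.integral_eq_sub_of_hasDerivAt (fun t _ => hderiv t)
    (hcont.intervalIntegrable _ _)

/-- `d/dt arctan (a t² + b t + c) = (2 a t + b) / (1 + (a t² + b t + c)²)`. [folklore] -/
theorem hasDerivAt_arctan_quadratic (a b c t : ℝ) :
    HasDerivAt (fun s => Real.arctan (a * s ^ 2 + b * s + c))
      ((2 * a * t + b) / (1 + (a * t ^ 2 + b * t + c) ^ 2)) t := by
  have hp : HasDerivAt (fun s : ℝ => a * s ^ 2 + b * s + c) (2 * a * t + b) t := by
    have := (((hasDerivAt_pow 2 t).const_mul a).add ((hasDerivAt_id t).const_mul b)).add_const c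
    refine this.congr_deriv ?_
    push_cast
    ring
  rw [show (2 * a * t + b) / (1 + (a * t ^ 2 + b * t + c) ^ 2) =
      1 / (1 + (a * t ^ 2 + b * t + c) ^ 2) * (2 * a * t + b) by ring]
  exact (Real.hasDerivAt_arctan _).comp t hp

/-! ### The arctangent family `[[0,1], (2a t + b) / (1 + (a t² + b t + c)²)]`, `a b c : ℚ` -/

/-- The integrand `(2a t + b) / (1 + (a t² + b t + c)²) = d/dt arctan (a t² + b t + c)` on `ℝ¹`
(file-local notation). -/
local notation3 "atF[" a ", " b ", " c "]" =>
  (fun x : Fin 1 → ℝ =>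
    (2 * ((a : ℚ) : ℝ) * x 0 + ((b : ℚ) : ℝ)) / (1 + (((a : ℚ) : ℝ) * x 0 ^ 2 + ((b : ℚ) : ℝ) * x 0 + ((c : ℚ) : ℝ)) ^ 2))

/-- The integrand of the arctangent family as a quotient of polynomials over `ℚ`. [folklore] -/
theorem atF_eq_aeval (a b c : ℚ) :
    atF[a, b, c] = fun x : Fin 1 → ℝ =>
      aeval x (C (2 * a) * X 0 + C b : MvPolynomial (Fin 1) ℚ) /
        aeval x (1 + (C a * X 0 ^ 2 + C b * X 0 + C c) ^ 2 : MvPolynomial (Fin 1) ℚ) := by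
  funext x
  simp [eq_ratCast]

/-- The denominator does not vanish. [folklore] -/
theorem aeval_atDen_ne_zero (a b c : ℚ) (x : Fin 1 → ℝ) :
    aeval x (1 + (C a * X 0 ^ 2 + C b * X 0 + C c) ^ 2 : MvPolynomial (Fin 1) ℚ) ≠ 0 := by
  simp only [map_add, map_one, map_pow, map_mul, aeval_C, aeval_X, eq_ratCast]
  positivity

/-- The integrand of the arctangent family is real analytic. [folklore] -/
theorem analyticOnNhd_atF (a b c : ℚ) (S : Set (Fin 1 → ℝ)) : AnalyticOnNhd ℝ atF[a, b, c] S := by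
  rw [atF_eq_aeval]
  exact analyticOnNhd_aeval_div _ _ (aeval_atDen_ne_zero a b c) S

/-- The integrand of the arctangent family is `ℚ`-semialgebraic on the cube.
[Bochnak–Coste–Roy 1998, §2.2] -/
theorem isSemialgebraicFunOn_atF (a b c : ℚ) : IsSemialgebraicFunOn ℚ (KZ.cube 1) atF[a, b, c] := by
  rw [atF_eq_aeval]
  exact isSemialgebraicFunOn_aeval_div_aeval KZ.isSemialgebraic_cube _ _
    fun x _ => aeval_atDen_ne_zero a b c x

/-- The tame cube class `[[0,1], (2a t + b)/(1 + (a t² + b t + c)²)]` (file-local notation). -/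
local notation3 "atR[" a ", " b ", " c "]" =>
  (IntegralRep.tameCube atF[a, b, c] (analyticOnNhd_atF a b c (KZ.cube 1))
    (isSemialgebraicFunOn_atF a b c) : IntegralRep 1)

/-- `[atR a b c]` is a tame cube class. [Ayoub 2014, Def. 6] -/
theorem of_atR_mem_cubicalGens (a b c : ℚ) : of atR[a, b, c] ∈ cubicalGens :=
  ⟨1, _, rfl, analyticOnNhd_atF a b c _, rfl⟩

/-- **Level-`0` slice of the arctangent family**:
`Sl 0 [atR a b c] = arctan (a/4 + b/2 + c) − arctan c`. [folklore] -/
theorem slice_zero_atR (a b c : ℚ) :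
    Sl[0] (of atR[a, b, c]) =
      Real.arctan ((a : ℝ) * (1 / 2) ^ 2 + b * (1 / 2) + c) - Real.arctan ((a : ℝ) * 0 ^ 2 + b * 0 + c) := by
  rw [slice_zero_of_dim_one _ rfl]
  simp only [IntegralRep.tameCube_integrand]
  refine integral_Icc_half_of_hasDerivAt (G := fun s => Real.arctan ((a : ℝ) * s ^ 2 + b * s + c))
    (fun t => hasDerivAt_arctan_quadratic a b c t) ?_
  refine Continuous.div (by fun_prop) (by fun_prop) fun t => ?_
  positivity

/-! ## §6 The witness: a dyadic subdivision relation of slice value `π / 2` -/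

/-- **The witness** `a₀ = [g] − [½ g(·/2)] − [½ g((1+·)/2)]`, `g = d/dt arctan (−16t² + 16t − 3)`:
the dyadic subdivision of `[[0,1], g]` along its only coordinate
(`½ g(t/2) = d/dt arctan (−4t² + 8t − 3)`, `½ g((1+t)/2) = d/dt arctan (1 − 4t²)`; file-local
notation). -/
local notation3 "𝔴" =>
  (of atR[(-16 : ℚ), (16 : ℚ), (-3 : ℚ)] - of atR[(-4 : ℚ), (8 : ℚ), (-3 : ℚ)]
    - of atR[(-4 : ℚ), (0 : ℚ), (1 : ℚ)] : FormalRep)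

/-- The witness is a dyadic subdivision generator of the cubical calculus. [Kontsevich–Zagier 2001, §1.2] -/
theorem witness_mem_cubicalSubdivGens : 𝔴 ∈ KZ.cubicalSubdivGens := by
  refine ⟨1, _, _, _, 0, rfl, analyticOnNhd_atF _ _ _ _, rfl, analyticOnNhd_atF _ _ _ _, rfl,
    analyticOnNhd_atF _ _ _ _, ?_, ?_, rfl⟩
  · intro x _
    simp only [IntegralRep.tameCube_integrand, Function.update_self]
    push_cast
    ring
  · intro x _
    simp only [IntegralRep.tameCube_integrand, Function.update_self]
    push_cast
    ring

/-- **The witness is a KZ relation** (subdivision = domain additivity + two affine changes of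
variables, `KZ.cubicalSubdivGens_subset_relations`). [Kontsevich–Zagier 2001, §1.2] -/
theorem witness_mem_relations : 𝔴 ∈ relations :=
  KZ.cubicalSubdivGens_subset_relations witness_mem_cubicalSubdivGens

/-- **The witness is a `ℤ`-combination of tame cube classes.** [Ayoub 2014, Def. 6] -/
theorem witness_mem_cubicalSpan : 𝔴 ∈ cubicalSpan :=
  cubicalSpan.sub_mem (cubicalSpan.sub_mem (AddSubgroup.subset_closure (of_atR_mem_cubicalGens _ _ _))
    (AddSubgroup.subset_closure (of_atR_mem_cubicalGens _ _ _)))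
    (AddSubgroup.subset_closure (of_atR_mem_cubicalGens _ _ _))

/-- **The level-`0` slice of the witness is `π / 2`**:
`(arctan 1 − arctan (−3)) − (arctan 0 − arctan (−3)) − (arctan 0 − arctan 1) = π/2`. [folklore] -/
theorem slice_zero_witness : Sl[0] 𝔴 = Real.pi / 2 := by
  simp only [map_sub, slice_zero_atR]
  norm_num [Real.arctan_one, Real.arctan_zero]
  ring

/-! ## §7 The arctangent kernel `κ` and the refutation -/

/-- The integrand `1/((1−u)²+u²)` of the bounded arctangent kernel `κ` as a quotient of polynomials
over `ℚ`. [Kontsevich–Zagier 2001, §1.1] -/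
theorem kappaFun_eq_aeval :
    (fun x : Fin 1 → ℝ => 1 / ((1 - x 0) ^ 2 + x 0 ^ 2)) = fun x : Fin 1 → ℝ =>
      aeval x (1 : MvPolynomial (Fin 1) ℚ) / aeval x ((1 - X 0) ^ 2 + X 0 ^ 2 : MvPolynomial (Fin 1) ℚ) := by
  funext x
  simp

/-- The denominator of the kernel does not vanish: `(1−u)² + u² ≥ ½`. [folklore] -/
theorem aeval_kappaDen_ne_zero (x : Fin 1 → ℝ) :
    aeval x ((1 - X 0) ^ 2 + X 0 ^ 2 : MvPolynomial (Fin 1) ℚ) ≠ 0 := by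
  have : (0 : ℝ) < (1 - x 0) ^ 2 + x 0 ^ 2 := by nlinarith [sq_nonneg (2 * x 0 - 1)]
  simpa using this.ne'

/-- The kernel integrand is real analytic. [folklore] -/
theorem analyticOnNhd_kappaFun (S : Set (Fin 1 → ℝ)) :
    AnalyticOnNhd ℝ (fun x : Fin 1 → ℝ => 1 / ((1 - x 0) ^ 2 + x 0 ^ 2)) S := by
  rw [kappaFun_eq_aeval]
  exact analyticOnNhd_aeval_div _ _ aeval_kappaDen_ne_zero S

/-- The kernel integrand is `ℚ`-semialgebraic on the cube. [Bochnak–Coste–Roy 1998, §2.2] -/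
theorem isSemialgebraicFunOn_kappaFun :
    IsSemialgebraicFunOn ℚ (KZ.cube 1) (fun x : Fin 1 → ℝ => 1 / ((1 - x 0) ^ 2 + x 0 ^ 2)) := by
  rw [kappaFun_eq_aeval]
  exact isSemialgebraicFunOn_aeval_div_aeval KZ.isSemialgebraic_cube _ _
    fun x _ => aeval_kappaDen_ne_zero x

/-- The kernel `κ = [[0,1], du/((1−u)²+u²)]` as a tame cube class (file-local notation). -/
local notation3 "κᵣ" =>
  (IntegralRep.tameCube (fun x : Fin 1 → ℝ => 1 / ((1 - x 0) ^ 2 + x 0 ^ 2))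
    (analyticOnNhd_kappaFun (KZ.cube 1)) isSemialgebraicFunOn_kappaFun : IntegralRep 1)

/-- `κᵣ` is the kernel `κ` of line `ayoub-stokes-cartier` (its `IsKappa`, unfolded). [folklore] -/
theorem kappaRep_isKappa :
    (κᵣ).domain = {x | x 0 ∈ Set.Icc (0 : ℝ) 1} ∧
      (κᵣ).integrand = fun x => 1 / ((1 - x 0) ^ 2 + x 0 ^ 2) := by
  refine ⟨?_, rfl⟩
  ext x
  simp [KZ.mem_cube, Fin.forall_fin_one]

/-- **Quantitative refutation.** For the arctangent kernel `κ` and the dyadic subdivision relation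
`𝔴 ∈ cubicalSpan ∩ KZ.relations`, NO `[κ]^N ⋆ 𝔴` lies in the last-coordinate Stokes module
`closure (KZ.cubicalLinGens ∪ KZ.cubicalStokesGens)`: the slice functional of level `N` is algebraic
there but takes the value `π/2` on `[κ]^N ⋆ 𝔴` (`π` is transcendental: Lindemann,
`transcendental_pi_holds`). [Ayoub 2014, Def. 10; Lindemann 1882] -/
theorem exists_kappa_iterate_not_mem_closure_lin_stokes :
    ∃ (κ : IntegralRep 1) (a : FormalRep),
      (κ.domain = {x | x 0 ∈ Set.Icc (0 : ℝ) 1} ∧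
          κ.integrand = fun x => 1 / ((1 - x 0) ^ 2 + x 0 ^ 2)) ∧
        a ∈ cubicalSpan ∧ a ∈ relations ∧
          ∀ N : ℕ, (fun x => of κ * x)^[N] a ∉
            AddSubgroup.closure (KZ.cubicalLinGens ∪ KZ.cubicalStokesGens) := by
  refine ⟨κᵣ, 𝔴, kappaRep_isKappa, witness_mem_cubicalSpan, witness_mem_relations, fun N hN => ?_⟩
  have halg := isAlgebraic_slice_of_mem_closure_lin_stokes N hN
  rw [slice_iterate_kappa_mul kappaRep_isKappa.1 kappaRep_isKappa.2, slice_zero_witness] at halg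
  have h2 := halg.mul (isAlgebraic_int (R := ℚ) (A := ℝ) 2)
  rw [show Real.pi / 2 * ((2 : ℤ) : ℝ) = Real.pi by push_cast; ring] at h2
  exact transcendental_pi_holds h2

/-- **Refutation of `stub_kernelControlModPi`** (line `ayoub-stokes-cartier` of crux
stmt-KontsevichZagierPeriods-3929; the registered signature with the line's local abbreviations
`IsKappa`, `ayoubIdeal` unfolded): it is NOT true that for the arctangent kernel `κ` every
`ℤ`-combination of tame cube classes lying in `KZ.relations` has some `[κ]^N`-multiple in the
last-coordinate Stokes module. [Ayoub 2014, Def. 10] -/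
theorem not_kernelControlModPi :
    ¬ ∀ κ : IntegralRep 1,
        (κ.domain = {x | x 0 ∈ Set.Icc (0 : ℝ) 1} ∧
            κ.integrand = fun x => 1 / ((1 - x 0) ^ 2 + x 0 ^ 2)) →
          ∀ a : FormalRep, a ∈ cubicalSpan → a ∈ relations →
            ∃ N : ℕ, (fun x => of κ * x)^[N] a ∈
              AddSubgroup.closure (KZ.cubicalLinGens ∪ KZ.cubicalStokesGens) := by
  intro h
  obtain ⟨κ, a, hκ, ha, har, hnot⟩ := exists_kappa_iterate_not_mem_closure_lin_stokes
  obtain ⟨N, hN⟩ := h κ hκ a ha har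
  exact hnot N hN

end Summit.KontsevichZagierPeriods.KontsevichZagierPeriods.ReducedPeriodRingNegative

end
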